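import Literature.NumberTheory.Automorphic.UnitaryGroupArchFactor
import HarnessLib

/-!
# The adelic lift: functions on the pieces `Γ_q \ U(σ_{w₁}J)(ℂ)` ↔ ONE function on `U(J)(F)\U(J)(𝔸_F)/K_c K`, generic rank `N`

For the tree's adelic unitary group `U(J)(𝔸_F) = (adelicGroupData F E c N J).Adelic` (number field `E`, `c ≠ 1` over `F` fixing the
infinite places, `J ∈ M_N(E)`, ONE complex place `w₁`), a subgroup `K ≤ U(J)(𝔸_{F,f})` and a SECTION `g : Q → U(J)(𝔸_{F,f})` of the double
cosets `U(J)(F) \ U(J)(𝔸_{F,f}) / K` (given by two hypotheses: COVER `∀ y, ∃ q γ k ∈ K, y = γ_f · g q · k` and DISJOINT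
`γ_f · g q · k = γ'_f · g q' · k' → q = q'`), this file proves the standard dictionary ([BorelJacquet1979, §4.3];
[BorelWallach2000, XIII 1.2]: «`Γ\(G₁ × G₂)/L = ∐_c Γ'_c\G₁`»; [Deligne1979ShimuraVarieties, 2.1.2]):

* §1 NORMAL FORM: `γ · x = ι_{w₁}(σ_{w₁}(γ) · x_{w₁}) · k_c · (1, γ_f x_f)` with `k_c` in the archimedean factor AWAY from `w₁`
  (`(ker archAt w₁).map archToAdelic`, ★ `UnitaryGroupArchFactor`);
* §2 VALUES FORCED ∕ UNIQUENESS: a function `Φ : U(J)(𝔸_F) → V` that is left `U(J)(F)`-invariant, right `K`-invariant and right-invariant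
  under the archimedean factor away from `w₁` is determined by its PIECE FUNCTIONS `u ↦ Φ (ι_{w₁}(u) · (1, g q))` on `U(σ_{w₁}J)(ℂ)`;
* §3 RESTRICTION: those piece functions are left-invariant under `Γ_q = {δ ∈ U(J)(F) | δ_f · g q ∈ g q · K}` acting through `σ_{w₁}`;
* §4 EXTENSION (existence): every family of `Γ_q`-invariant piece functions `f_q : U(σ_{w₁}J)(ℂ) → V` IS the family of piece functions of
  a (unique) such `Φ`; §5 `Φ = 0` iff all `f_q = 0`.

This is the rank-`N`, value-generic, def-free form of the «adelic lift» (`p = 2` template: ★ `UnitaryBallAdelicLift`); the record curve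
(`RecordSystemGS.pieces`, `ShimuraSetGS.mk_eq_mk_iff`) supplies `(Q, g, cover, disjoint)` at `N = 2`.  THEOREMS ONLY; no named fact,
no instance, no notation, no `sorry`.

## References
* [BorelJacquet1979] A. Borel, H. Jacquet, Corvallis PSPM 33.1, §4.1 (`G(𝔸) = G_∞ × G(𝔸_f)`), §4.3 (automorphic forms on `G(𝔸)` vs on
  `G_∞`: «the functions on `Γ_i \ G_∞`»).
* [BorelWallach2000] A. Borel, N. Wallach, 2nd ed., XIII 1.2 (adelic double cosets `Γ\(G₁ × G₂)/L = ∐_c Γ'_c\G₁`).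
* [Deligne1979ShimuraVarieties] P. Deligne, Corvallis PSPM 33.2, 2.1.2 («a disjoint sum, indexed by `G(ℚ)\G(𝔸^f)/K`, of the quotients `Γ_g\X⁺`»).
-/

noncomputable section

open NumberField NumberField.InfinitePlace Topology

open scoped Matrix MatrixGroups ComplexConjugate ComplexOrder

namespace Literature.NumberTheory.Automorphic

namespace UnitaryGroup

open NumberField.mixedEmbedding

variable (F E : Type) [Field F] [NumberField F] [Field E] [NumberField E] [Algebra F E]
  (c : E ≃ₐ[F] E) (N : ℕ) (J : Matrix (Fin N) (Fin N) E)
  (hc : c ≠ 1) (hfix : ∀ w : InfinitePlace E, c • w = w) (w₁ : {w : InfinitePlace E // IsComplex w})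

/-! ## §1 Normal form of `γ · x` -/

/-- **`(γ)_∞ = γ ⊗ 1`** (datum form of ★ `archPart_toAdelic`). [cite: BorelJacquet1979, §4.1] -/
theorem archPart_toAdelic' (γ : rational F E c N J) :
    archPart F E c N J ((adelicGroupData F E c N J).toAdelic γ) = rationalToArch F E c N J γ :=
  archPart_toAdelic F E c N J γ

/-- **`(γ)_f = γ_f`** (datum form of ★ `finPart_toAdelic`). [cite: BorelJacquet1979, §4.1] -/
theorem finPart_toAdelic' (γ : rational F E c N J) :
    finPart F E c N J ((adelicGroupData F E c N J).toAdelic γ) = rationalToFinAdelic F E c N J γ :=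
  finPart_toAdelic F E c N J γ

/-- **`γ = (γ ⊗ 1, 1) · (1, γ_f)`** for a rational point. [cite: BorelJacquet1979, §4.1] -/
theorem toAdelic_eq_archToAdelic_mul_finAdelicToAdelic (γ : rational F E c N J) :
    (adelicGroupData F E c N J).toAdelic γ =
      archToAdelic F E c N J (rationalToArch F E c N J γ) * finAdelicToAdelic F E c N J (rationalToFinAdelic F E c N J γ) := by
  conv_lhs => rw [← archToAdelic_mul_finAdelicToAdelic F E c N J ((adelicGroupData F E c N J).toAdelic γ)]
  rw [archPart_toAdelic', finPart_toAdelic']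

/-- **Normal form**: `γ · x = ι_{w₁}(σ_{w₁}(γ) · x_{w₁}) · k_c · (1, γ_f · x_f)` with `k_c` archimedean away from `w₁`
(`x_{w₁} := (x_∞)_{w₁}`). [cite: BorelJacquet1979, §4.1] -/
theorem exists_toAdelic_mul_eq (γ : rational F E c N J) (x : (adelicGroupData F E c N J).Adelic) :
    ∃ kc ∈ ((archAt F E c N J w₁ (hfix w₁.1) hc).ker).map (archToAdelic F E c N J),
      (adelicGroupData F E c N J).toAdelic γ * x =
        adelicSingle F E c N J hc hfix w₁
            (rationalToArchLocal F E c N J w₁ (hfix w₁.1) hc γ * archAt F E c N J w₁ (hfix w₁.1) hc (archPart F E c N J x)) *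
          kc * finAdelicToAdelic F E c N J (rationalToFinAdelic F E c N J γ * finPart F E c N J x) := by
  -- split the archimedean part of `γ · x` at `w₁`
  obtain ⟨a', ha', h⟩ := exists_eq_archSingle_mul F E c N J hc hfix w₁ (rationalToArch F E c N J γ * archPart F E c N J x)
  refine ⟨archToAdelic F E c N J a', ⟨a', MonoidHom.mem_ker.2 ha', rfl⟩, ?_⟩
  have hx := archToAdelic_mul_finAdelicToAdelic F E c N J x
  have hcomm := (commute_archToAdelic_finAdelicToAdelic F E c N J (archPart F E c N J x) (rationalToFinAdelic F E c N J γ)).eq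
  calc (adelicGroupData F E c N J).toAdelic γ * x
      = archToAdelic F E c N J (rationalToArch F E c N J γ) * finAdelicToAdelic F E c N J (rationalToFinAdelic F E c N J γ) *
          (archToAdelic F E c N J (archPart F E c N J x) * finAdelicToAdelic F E c N J (finPart F E c N J x)) := by
        rw [toAdelic_eq_archToAdelic_mul_finAdelicToAdelic, hx]
    _ = archToAdelic F E c N J (rationalToArch F E c N J γ * archPart F E c N J x) *
          finAdelicToAdelic F E c N J (rationalToFinAdelic F E c N J γ * finPart F E c N J x) := by
        rw [map_mul, map_mul, mul_assoc, mul_assoc, ← mul_assoc (finAdelicToAdelic F E c N J _), ← hcomm, mul_assoc]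
    _ = _ := by
        rw [h, map_mul, map_mul, archAt_rationalToArch, adelicSingle_apply]

/-! ## §2 Values forced by the piece functions; uniqueness -/

variable {F E c N J hc hfix w₁}

/-- **Values are forced by the pieces**: if `Φ` is left `U(J)(F)`-invariant, right `K`-invariant and right-invariant under the
archimedean factor away from `w₁`, and `x_f = γ_f · g_q · k` with `k ∈ K`, then `Φ x = Φ (ι_{w₁}(σ_{w₁}(γ)⁻¹ x_{w₁}) · (1, g_q))`.
[cite: BorelJacquet1979, §4.3] [cite: BorelWallach2000, XIII 1.2] -/
theorem apply_eq_apply_adelicSingle_mul_of_finPart_eq {V : Type*} {K : Subgroup (finAdelic F E c N J)}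
    {Φ : (adelicGroupData F E c N J).Adelic → V}
    (hL : ∀ (γ : rational F E c N J) (x : (adelicGroupData F E c N J).Adelic),
      Φ ((adelicGroupData F E c N J).toAdelic γ * x) = Φ x)
    (hKc : ∀ k ∈ ((archAt F E c N J w₁ (hfix w₁.1) hc).ker).map (archToAdelic F E c N J),
      ∀ x : (adelicGroupData F E c N J).Adelic, Φ (x * k) = Φ x)
    (hK : ∀ k ∈ K, ∀ x : (adelicGroupData F E c N J).Adelic, Φ (x * finAdelicToAdelic F E c N J k) = Φ x)
    {x : (adelicGroupData F E c N J).Adelic} {γ : rational F E c N J} {gq k : finAdelic F E c N J} (hk : k ∈ K)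
    (hx : finPart F E c N J x = rationalToFinAdelic F E c N J γ * gq * k) :
    Φ x = Φ (adelicSingle F E c N J hc hfix w₁
      (rationalToArchLocal F E c N J w₁ (hfix w₁.1) hc γ⁻¹ * archAt F E c N J w₁ (hfix w₁.1) hc (archPart F E c N J x)) *
        finAdelicToAdelic F E c N J gq) := by
  obtain ⟨kc, hkc, h⟩ := exists_toAdelic_mul_eq F E c N J hc hfix w₁ γ⁻¹ x
  have hfin : rationalToFinAdelic F E c N J γ⁻¹ * finPart F E c N J x = gq * k := by
    rw [hx, map_inv, ← mul_assoc, ← mul_assoc, inv_mul_cancel, one_mul]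
  rw [← hL γ⁻¹ x, h, hfin, map_mul (finAdelicToAdelic F E c N J) gq k, ← mul_assoc, hK k hk, mul_assoc,
    mul_finAdelicToAdelic_of_mem_map_ker_archAt F E c N J hc hfix w₁ kc hkc gq, ← mul_assoc, hKc kc hkc]

/-- **Uniqueness**: two such functions with the same piece functions `u ↦ Φ (ι_{w₁}(u) · (1, g_q))` on a COVERING family of representatives
`g : Q → U(J)(𝔸_{F,f})` are equal. [cite: BorelJacquet1979, §4.3] [cite: BorelWallach2000, XIII 1.2] -/
theorem eq_of_forall_apply_adelicSingle_mul_eq {V : Type*} {K : Subgroup (finAdelic F E c N J)} {Q : Type*}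
    {g : Q → finAdelic F E c N J}
    (hcov : ∀ y : finAdelic F E c N J, ∃ (q : Q) (γ : rational F E c N J) (k : finAdelic F E c N J),
      k ∈ K ∧ y = rationalToFinAdelic F E c N J γ * g q * k)
    {Φ Ψ : (adelicGroupData F E c N J).Adelic → V}
    (hL : ∀ (γ : rational F E c N J) (x : (adelicGroupData F E c N J).Adelic),
      Φ ((adelicGroupData F E c N J).toAdelic γ * x) = Φ x)
    (hKc : ∀ k ∈ ((archAt F E c N J w₁ (hfix w₁.1) hc).ker).map (archToAdelic F E c N J),
      ∀ x : (adelicGroupData F E c N J).Adelic, Φ (x * k) = Φ x)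
    (hK : ∀ k ∈ K, ∀ x : (adelicGroupData F E c N J).Adelic, Φ (x * finAdelicToAdelic F E c N J k) = Φ x)
    (hL' : ∀ (γ : rational F E c N J) (x : (adelicGroupData F E c N J).Adelic),
      Ψ ((adelicGroupData F E c N J).toAdelic γ * x) = Ψ x)
    (hKc' : ∀ k ∈ ((archAt F E c N J w₁ (hfix w₁.1) hc).ker).map (archToAdelic F E c N J),
      ∀ x : (adelicGroupData F E c N J).Adelic, Ψ (x * k) = Ψ x)
    (hK' : ∀ k ∈ K, ∀ x : (adelicGroupData F E c N J).Adelic, Ψ (x * finAdelicToAdelic F E c N J k) = Ψ x)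
    (h : ∀ (q : Q) (u : archLocal E N J w₁),
      Φ (adelicSingle F E c N J hc hfix w₁ u * finAdelicToAdelic F E c N J (g q)) =
        Ψ (adelicSingle F E c N J hc hfix w₁ u * finAdelicToAdelic F E c N J (g q))) :
    Φ = Ψ := by
  funext x
  obtain ⟨q, γ, k, hk, hx⟩ := hcov (finPart F E c N J x)
  rw [apply_eq_apply_adelicSingle_mul_of_finPart_eq hL hKc hK hk hx,
    apply_eq_apply_adelicSingle_mul_of_finPart_eq hL' hKc' hK' hk hx, h]

/-! ## §3 Restriction: the piece functions are `Γ_q`-invariant -/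

/-- **Restriction**: the piece function `u ↦ Φ (ι_{w₁}(u) · (1, g_q))` of a left `U(J)(F)`-invariant, right `K`- and away-from-`w₁`-invariant
`Φ` is LEFT-INVARIANT under `Γ_q = {δ | δ_f · g_q ∈ g_q · K}` acting through `σ_{w₁}`. [cite: BorelJacquet1979, §4.3]
[cite: Deligne1979ShimuraVarieties, 2.1.2] -/
theorem apply_adelicSingle_rationalToArchLocal_mul {V : Type*} {K : Subgroup (finAdelic F E c N J)}
    {Φ : (adelicGroupData F E c N J).Adelic → V}
    (hL : ∀ (γ : rational F E c N J) (x : (adelicGroupData F E c N J).Adelic),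
      Φ ((adelicGroupData F E c N J).toAdelic γ * x) = Φ x)
    (hKc : ∀ k ∈ ((archAt F E c N J w₁ (hfix w₁.1) hc).ker).map (archToAdelic F E c N J),
      ∀ x : (adelicGroupData F E c N J).Adelic, Φ (x * k) = Φ x)
    (hK : ∀ k ∈ K, ∀ x : (adelicGroupData F E c N J).Adelic, Φ (x * finAdelicToAdelic F E c N J k) = Φ x)
    (gq : finAdelic F E c N J) {δ : rational F E c N J} {k : finAdelic F E c N J} (hk : k ∈ K)
    (hδ : rationalToFinAdelic F E c N J δ * gq = gq * k) (u : archLocal E N J w₁) :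
    Φ (adelicSingle F E c N J hc hfix w₁ (rationalToArchLocal F E c N J w₁ (hfix w₁.1) hc δ * u) * finAdelicToAdelic F E c N J gq) =
      Φ (adelicSingle F E c N J hc hfix w₁ u * finAdelicToAdelic F E c N J gq) := by
  set x := adelicSingle F E c N J hc hfix w₁ u * finAdelicToAdelic F E c N J gq with hxdef
  obtain ⟨kc, hkc, h⟩ := exists_toAdelic_mul_eq F E c N J hc hfix w₁ δ x
  have harch : archAt F E c N J w₁ (hfix w₁.1) hc (archPart F E c N J x) = u := by
    rw [hxdef, map_mul, archPart_finAdelicToAdelic, mul_one, adelicSingle_apply, archPart_archToAdelic, archAt_archSingle_self]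
  have hfin : finPart F E c N J x = gq := by
    rw [hxdef, map_mul, adelicSingle_apply, finPart_archToAdelic, one_mul, finPart_finAdelicToAdelic]
  rw [← hL δ x, h, harch, hfin, hδ, map_mul (finAdelicToAdelic F E c N J) gq k, ← mul_assoc, hK k hk, mul_assoc,
    mul_finAdelicToAdelic_of_mem_map_ker_archAt F E c N J hc hfix w₁ kc hkc gq, ← mul_assoc, hKc kc hkc]

/-! ## §4 Extension: every `Γ_q`-invariant family of piece functions lifts -/

omit [NumberField F] in
/-- TRANSFER between two decompositions of the same finite-adelic point: if `γ_f g_q k = γ'_f g_{q'} k'` (`k, k' ∈ K`) then `q = q'`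
(DISJOINT) and a `Γ_q`-invariant family takes the same value at `σ(γ)⁻¹ a` and `σ(γ')⁻¹ a`. [cite: BorelWallach2000, XIII 1.2] -/
theorem transfer_of_eq {V : Type*} {K : Subgroup (finAdelic F E c N J)} {Q : Type*} {g : Q → finAdelic F E c N J}
    (hdisj : ∀ (q q' : Q) (γ γ' : rational F E c N J) (k k' : finAdelic F E c N J), k ∈ K → k' ∈ K →
      rationalToFinAdelic F E c N J γ * g q * k = rationalToFinAdelic F E c N J γ' * g q' * k' → q = q')
    {f : Q → archLocal E N J w₁ → V}
    (hf : ∀ (q : Q) (δ : rational F E c N J), (∃ k ∈ K, rationalToFinAdelic F E c N J δ * g q = g q * k) →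
      ∀ u : archLocal E N J w₁, f q (rationalToArchLocal F E c N J w₁ (hfix w₁.1) hc δ * u) = f q u)
    {q q' : Q} {γ γ' : rational F E c N J} {k k' : finAdelic F E c N J} (hk : k ∈ K) (hk' : k' ∈ K)
    (h : rationalToFinAdelic F E c N J γ * g q * k = rationalToFinAdelic F E c N J γ' * g q' * k') (a : archLocal E N J w₁) :
    q = q' ∧ f q' (rationalToArchLocal F E c N J w₁ (hfix w₁.1) hc γ'⁻¹ * a) =
      f q (rationalToArchLocal F E c N J w₁ (hfix w₁.1) hc γ⁻¹ * a) := by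
  obtain rfl : q = q' := hdisj q q' γ γ' k k' hk hk' h
  refine ⟨rfl, ?_⟩
  -- `δ := γ'⁻¹ γ ∈ Γ_q`: `δ_f g_q = g_q (k' k⁻¹)`
  have hδ : rationalToFinAdelic F E c N J (γ'⁻¹ * γ) * g q = g q * (k' * k⁻¹) := by
    have h1 : rationalToFinAdelic F E c N J γ * g q = rationalToFinAdelic F E c N J γ' * g q * k' * k⁻¹ := by
      rw [← h, mul_inv_cancel_right]
    rw [map_mul, map_inv, mul_assoc, h1]
    group
  have hinv := hf q (γ'⁻¹ * γ) ⟨k' * k⁻¹, K.mul_mem hk' (K.inv_mem hk), hδ⟩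
    (rationalToArchLocal F E c N J w₁ (hfix w₁.1) hc γ⁻¹ * a)
  rw [← mul_assoc, ← map_mul, mul_assoc γ'⁻¹, mul_inv_cancel, mul_one] at hinv
  exact hinv

/-- **Extension (the adelic lift exists)**: given a COVERING and DISJOINT family of representatives `g : Q → U(J)(𝔸_{F,f})` of
`U(J)(F)\U(J)(𝔸_{F,f})/K` and piece functions `f_q : U(σ_{w₁}J)(ℂ) → V` left-invariant under `Γ_q` through `σ_{w₁}`, there is a function
`Φ` on `U(J)(𝔸_F)`, left `U(J)(F)`-invariant, right `K`-invariant and right-invariant under the archimedean factor away from `w₁`, whose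
piece functions are the `f_q`: `Φ (ι_{w₁}(u) · (1, g_q)) = f_q u`. [cite: BorelJacquet1979, §4.3] [cite: BorelWallach2000, XIII 1.2]
[cite: Deligne1979ShimuraVarieties, 2.1.2] -/
theorem exists_lift_of_pieces {V : Type*} {K : Subgroup (finAdelic F E c N J)} {Q : Type*} {g : Q → finAdelic F E c N J}
    (hcov : ∀ y : finAdelic F E c N J, ∃ (q : Q) (γ : rational F E c N J) (k : finAdelic F E c N J),
      k ∈ K ∧ y = rationalToFinAdelic F E c N J γ * g q * k)
    (hdisj : ∀ (q q' : Q) (γ γ' : rational F E c N J) (k k' : finAdelic F E c N J), k ∈ K → k' ∈ K →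
      rationalToFinAdelic F E c N J γ * g q * k = rationalToFinAdelic F E c N J γ' * g q' * k' → q = q')
    (f : Q → archLocal E N J w₁ → V)
    (hf : ∀ (q : Q) (δ : rational F E c N J), (∃ k ∈ K, rationalToFinAdelic F E c N J δ * g q = g q * k) →
      ∀ u : archLocal E N J w₁, f q (rationalToArchLocal F E c N J w₁ (hfix w₁.1) hc δ * u) = f q u) :
    ∃ Φ : (adelicGroupData F E c N J).Adelic → V,
      (∀ (γ : rational F E c N J) (x : (adelicGroupData F E c N J).Adelic),
        Φ ((adelicGroupData F E c N J).toAdelic γ * x) = Φ x) ∧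
      (∀ k ∈ ((archAt F E c N J w₁ (hfix w₁.1) hc).ker).map (archToAdelic F E c N J),
        ∀ x : (adelicGroupData F E c N J).Adelic, Φ (x * k) = Φ x) ∧
      (∀ k ∈ K, ∀ x : (adelicGroupData F E c N J).Adelic, Φ (x * finAdelicToAdelic F E c N J k) = Φ x) ∧
      ∀ (q : Q) (u : archLocal E N J w₁), Φ (adelicSingle F E c N J hc hfix w₁ u * finAdelicToAdelic F E c N J (g q)) = f q u := by
  classical
  have hcov' := hcov
  choose qf γf kf hkf hyf using hcov'
  -- the lift, read off the chosen decomposition of the finite part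
  let Φ : (adelicGroupData F E c N J).Adelic → V := fun x =>
    f (qf (finPart F E c N J x))
      (rationalToArchLocal F E c N J w₁ (hfix w₁.1) hc (γf (finPart F E c N J x))⁻¹ *
        archAt F E c N J w₁ (hfix w₁.1) hc (archPart F E c N J x))
  have hΦ : ∀ x, Φ x = f (qf (finPart F E c N J x))
      (rationalToArchLocal F E c N J w₁ (hfix w₁.1) hc (γf (finPart F E c N J x))⁻¹ *
        archAt F E c N J w₁ (hfix w₁.1) hc (archPart F E c N J x)) := fun _ => rfl
  -- the key: any OTHER decomposition of `x_f` gives the same value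
  have key : ∀ (x : (adelicGroupData F E c N J).Adelic) (q : Q) (γ : rational F E c N J) (k : finAdelic F E c N J),
      k ∈ K → finPart F E c N J x = rationalToFinAdelic F E c N J γ * g q * k →
      Φ x = f q (rationalToArchLocal F E c N J w₁ (hfix w₁.1) hc γ⁻¹ * archAt F E c N J w₁ (hfix w₁.1) hc (archPart F E c N J x)) := by
    intro x q γ k hk hx
    have h2 := (transfer_of_eq hdisj hf hk (hkf (finPart F E c N J x)) (hx.symm.trans (hyf (finPart F E c N J x)))
      (archAt F E c N J w₁ (hfix w₁.1) hc (archPart F E c N J x)))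
    obtain ⟨hq, hval⟩ := h2
    rw [hΦ, ← hq] at *
    rw [← hq] at hval
    exact hval
  refine ⟨Φ, fun γ₀ x => ?_, fun kc hkc x => ?_, fun k₀ hk₀ x => ?_, fun q u => ?_⟩
  · -- left invariance
    obtain ⟨q, γ, k, hk, hx⟩ := hcov (finPart F E c N J x)
    have hx' : finPart F E c N J ((adelicGroupData F E c N J).toAdelic γ₀ * x) =
        rationalToFinAdelic F E c N J (γ₀ * γ) * g q * k := by
      rw [map_mul, finPart_toAdelic', hx, map_mul, mul_assoc, mul_assoc, mul_assoc]
    rw [key _ q (γ₀ * γ) k hk hx', key x q γ k hk hx]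
    congr 1
    simp only [map_mul, archPart_toAdelic', archAt_rationalToArch, map_inv, mul_inv_rev, mul_assoc, inv_mul_cancel_left]
  · -- right invariance under the archimedean factor away from `w₁`
    obtain ⟨a, ha, rfl⟩ := hkc
    have ha1 : archAt F E c N J w₁ (hfix w₁.1) hc a = 1 := MonoidHom.mem_ker.1 ha
    rw [hΦ, hΦ, map_mul, finPart_archToAdelic, mul_one, map_mul, archPart_archToAdelic, map_mul, ha1, mul_one]
  · -- right `K`-invariance
    obtain ⟨q, γ, k, hk, hx⟩ := hcov (finPart F E c N J x)
    have hx' : finPart F E c N J (x * finAdelicToAdelic F E c N J k₀) = rationalToFinAdelic F E c N J γ * g q * (k * k₀) := by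
      rw [map_mul, finPart_finAdelicToAdelic, hx, mul_assoc]
    rw [key _ q γ (k * k₀) (K.mul_mem hk hk₀) hx', key x q γ k hk hx, map_mul, archPart_finAdelicToAdelic, mul_one]
  · -- the piece functions
    have hx : finPart F E c N J (adelicSingle F E c N J hc hfix w₁ u * finAdelicToAdelic F E c N J (g q)) =
        rationalToFinAdelic F E c N J 1 * g q * 1 := by
      rw [map_mul, adelicSingle_apply, finPart_archToAdelic, one_mul, finPart_finAdelicToAdelic, map_one, one_mul, mul_one]
    rw [key _ q 1 1 K.one_mem hx, inv_one, map_one, one_mul, map_mul, adelicSingle_apply, archPart_archToAdelic,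
      archPart_finAdelicToAdelic, mul_one, archAt_archSingle_self]

/-! ## §5 The lift vanishes iff every piece function vanishes -/

/-- **`Φ = 0 ↔ ∀ q, f_q = 0`** for a lift `Φ` of the family `(f_q)` (any function with the four properties of §4).
[cite: BorelJacquet1979, §4.3] [cite: BorelWallach2000, XIII 1.2] -/
theorem lift_eq_zero_iff {V : Type*} [Zero V] {K : Subgroup (finAdelic F E c N J)} {Q : Type*} {g : Q → finAdelic F E c N J}
    (hcov : ∀ y : finAdelic F E c N J, ∃ (q : Q) (γ : rational F E c N J) (k : finAdelic F E c N J),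
      k ∈ K ∧ y = rationalToFinAdelic F E c N J γ * g q * k)
    {f : Q → archLocal E N J w₁ → V} {Φ : (adelicGroupData F E c N J).Adelic → V}
    (hL : ∀ (γ : rational F E c N J) (x : (adelicGroupData F E c N J).Adelic),
      Φ ((adelicGroupData F E c N J).toAdelic γ * x) = Φ x)
    (hKc : ∀ k ∈ ((archAt F E c N J w₁ (hfix w₁.1) hc).ker).map (archToAdelic F E c N J),
      ∀ x : (adelicGroupData F E c N J).Adelic, Φ (x * k) = Φ x)
    (hK : ∀ k ∈ K, ∀ x : (adelicGroupData F E c N J).Adelic, Φ (x * finAdelicToAdelic F E c N J k) = Φ x)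
    (hΦ : ∀ (q : Q) (u : archLocal E N J w₁), Φ (adelicSingle F E c N J hc hfix w₁ u * finAdelicToAdelic F E c N J (g q)) = f q u) :
    Φ = 0 ↔ ∀ (q : Q) (u : archLocal E N J w₁), f q u = 0 := by
  refine ⟨fun h q u => by rw [← hΦ q u, h]; rfl, fun h => ?_⟩
  exact eq_of_forall_apply_adelicSingle_mul_eq hcov hL hKc hK (fun _ _ => rfl) (fun _ _ _ => rfl) (fun _ _ _ => rfl)
    fun q u => by rw [hΦ q u, h q u]; rfl

end UnitaryGroup

end Literature.NumberTheory.Automorphic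

end
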